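import Summits.QuantumFields.YangMills.Theorems.BalabanUVNodesN16OfEntryAtRecord13CoPH
import Summits.QuantumFields.YangMills.Theorems.BalabanUVNodesN16PinnedLooseMatchSqueezeClassRadius

/-!
# Route «BalabanUVNodes», crux K3⁸ `SpineGivenEndpointR13SepCoPHV` (stmt-QuantumFields-27366), node N16 = NE3 — THE TOP KNIT, PART (B1): module 50's (β16) PRODUCER WITH NODE
# N19′'s COMPLETE N16-LETTER BLOCK, RE-KEYED FROM node N05's ℤᵈ `h5` TO node N16's OWN CHAIN-ENTRY OBJECT `hE` («(T4ᵀ_print)_β with one `(c₁′, B, B_h)` ∀ k ≥ 1», module 57)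

Cell `pub-ymgap`, seat `pub-ymgap-dag-n16-e` (R134 acceleration seat (a), strategy s2 = BY-NAME KNIT at the record; HUMAN RULING D-0062; chair R424 venue), generation 24,
module 59a (THEOREMS ONLY, 0 `def`, 0 `sorry`, standard axioms; Theses-free, importable).  `--kind proof --supports stmt-QuantumFields-27366 --as helper` (count-neutral;
proves NO registered stub).  `bears_on: R4∕N16 · edges N05 → N16, N07 → N16 · junction N16 → N19′ · composite N27`.

WHY (HOME `HANDOFF.md` §g23 «THE TOP KNIT» (b); module 57 `…N16OfEntryAtRecord13CoPH` p688434; module 58 `…N16Stage3OfFamilyMat`).  K3⁸'s stub 1 displays node N16 through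
`GuardedReadingN16` (`N16PinnedLoose ∧ N16LettersEnd ∧ N16RadiusMatch`) and the N16 conjunct of `KeyedRatesHolderD4V` (`N16HolderAtReading`); this seat's producers of those rows
(modules 47∕49∕50∕53∕54A) bottom out at node N05's `h5` in the ℤᵈ currency (Thm-4 ∕ Prop-3 BODIES on the pinned all-torus members of `zdGF3 (M_N ℂ) F.L β len`), which node N05's
booked object (the κ-periodic Σ-object, p681888) does not serve.  Module 57 re-keyed the reading-level knit on N16's OWN θ-free chain-entry object `hE`; module 58 bridges N05's
Σ-object to `hE`.  THIS MODULE is module 50 (`…N16PinnedLooseMatchSqueezeClassRadius`, p627812) §1–§4 with `h5 ↦ hE` and dag-n16-c's PRINT β-slot `PrintSlotHolder` for the ℤᵈ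
leaf slot `LeafSlotHolderAT`: statements = module 50's under that substitution (the sign condition `0 ≤ β` is no longer needed — `n16HolderAt_of_inEndRegimeH_printSlotHolder` asks
only `β ≤ 1`); proofs VERBATIM but for the bottom (module 57's `exists_window_letters_entry` ∕ `printSlotHolder_ofRecord_of_entry_window_linear` in place of module 27 §1 ∕ (F2′)),
the slot transport (§0 `printSlotHolder_reletter`, definitional) and the closer.  Module 59b does the same for module 53's junction producer and module 54A's adapter.

WHAT IS PROVED ([folklore] bookkeeping BY NAME + module 49's scalar arithmetic; no estimate).  §0 `printSlotHolder_reletter` · §1 `exists_letters_inEndRegimeH_printSlotHolder_classRadius_of_entry_loose`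
· §2 `…_of_entry_reg910Slot` · §3 ★ `exists_letters_n16HolderAtReading_loose_squeezeFull_of_entry_reg910Slot` · §4 ★ `exists_letters_g_n16HolderAtReading_loose_squeezeFull_of_entry_reg910Slot`.

HONEST FRAMING.  Bookkeeping BY NAME; no estimate.  `hE` ([Balaban1985RegularSpaces] Thm 4 p. 88 with Prop. 3's letters, Hölder member at exponent `β` AS PRINTED, all-torus
geometry, every depth, ONE threshold) and the SLOT KEY (node N07 — [Balaban1985Variational] Thm 1 (9)–(10) on the collar-slot cubes: `G hGm hG C hR`) are DISPLAYED HYPOTHESES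
asserted for no family; `hE` is inhabited by node N05's Σ-object GIVEN node N06's per-period binders (module 58; N06 content) or by the ℤᵈ `h5` GIVEN [4]'s letters at unbounded
domains; no stub of K3⁸ v7 (`stub_rates13HV` ∕ `stub_expansion13HV`) is closed or claimed; **N16 ∕ N05 ∕ N06 ∕ N07 ∕ N19′ ∕ N27 NOT discharged**; counts UNMOVED (typed 28∕28 ·
discharged 7∕27 · A 7∕28 — the chair's line is the only count).  One finite four-torus at fixed `ε`, Bałaban AS PRINTED — NOT ℝ⁴, NOT infinite volume, NOT OS, NOT a mass gap;
the Yang–Mills mass gap (Clay) is NOT proved by any of this — R4 closes the conditional finite-𝕋⁴ rung `BalabanLadder.UV` only.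
References: [Balaban1985RegularSpaces] T. Bałaban, CMP **99** (1985) 75–102, Thm 4 p. 88, Prop. 3 p. 87; [Balaban1985Variational] T. Bałaban, CMP **102** (1985) 277–309, Thm 1 p. 279.
-/

set_option autoImplicit false

open scoped BigOperators Matrix Matrix.Norms.L2Operator
open NormedSpace

namespace Summit.QuantumFields.YangMills.BalabanUVNodes.N16EntrySqueezeClassRadius

open Literature.MathematicalPhysics.QuantumFieldTheory.Balaban1983to89
open Literature.MathematicalPhysics.QuantumFieldTheory.Balaban1983to89.T4Continuum (T4Family ULoop)
open B7Prop1Explicit B7Prop2Explicit MatrixLog UnitaryModel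
open T4AveragingDeficitWall hiding Site Plane Plaq Bond
open B7Eq92Concrete (mgauge)
open B8Ineq132 (covDerivFwd)
open B8Eq184Proof (cfgExp)
open B8Eq119TwistedAxial (Restr129)
open B8Eq138LandauZd (covLap IsLandau138)
open B8Thm4TorusAt (torusLam Thm4TorusAt)
open Node00 (Stage13HParams NE3Objects₁₁ NE3Letters₁₁ ne3ConstLayerOfRecord₁₁ ne3NperOfRecord₁₁ ne3DomOfRecord₁₁ one_le_ne3NperOfRecord₁₁ MatA)
open Summit.QuantumFields.BalabanUV.T4Continuum
open BlockAverageCurrent (curConst)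
open NE3RightInverseSupLetters (frameC)
open NE3.LeafIndexSockets (LeafH3sup)
open MinimalActionSandwich (IsMinimiser)
open MinimalActionRate (sfClass)
open MinimalActionRefine (gradConst)
open MinimalActionDictionary (torusVP RadiiMono)
open AveragingDeficitLatticeH2Prep (fd)
open B11 (Regularity)
open YMDAG.UVSplit (NE3Carriers ne3OfRecord₁₁ RateReading₁₃CoPH rateCarriersOfRecord₁₃CoPH)
open Summit.QuantumFields.YangMills.BalabanUVNodes.N16HolderDefs (N16HolderAt)
open Summit.QuantumFields.YangMills.BalabanUVNodes.N16HolderRegime (PrintSlotHolder InEndRegimeH radiusOfRecordH constOfRecordH radiusOfRecordH_pos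
  n16HolderAt_of_inEndRegimeH_printSlotHolder)
open Summit.QuantumFields.YangMills.BalabanUVNodes.N16HolderSlotWindow (inEndRegimeH_ofRecord_of_window)
open Summit.QuantumFields.YangMills.BalabanUVNodes.N16OfEntryAtRecord13CoPH (exists_window_letters_entry printSlotHolder_ofRecord_of_entry_window_linear)
open Summit.QuantumFields.YangMills.BalabanUVNodes.N16H7LooseOfReg910Slot (h7Shape_loose_of_reg910Slot)
open Summit.QuantumFields.YangMills.BalabanUVNodes.N16PinnedLayer13CoPH (N16PinnedLoose N16LettersEnd N16HolderAtReading n16HolderAtReading_of_pinnedLoose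
  rateCarriers_ne3_of_pinnedLoose)
open Summit.QuantumFields.YangMills.BalabanUVNodes.N16PinnedLooseMatch (n16HolderAt_anti_dom looseDom_anti)
open Summit.QuantumFields.YangMills.BalabanUVNodes.N16 (gradConst_four_pos)
open Summit.QuantumFields.YangMills.BalabanUVNodes.N16PinnedLooseMatchSqueeze (inEndRegimeH_reletter squeezeLetters_spec)

noncomputable section

/-! ## §0 The print β-slot reads no `b ∕ g ∕ C` -/

/-- **dag-n16-c's PRINT β-SLOT DOES NOT READ THE LETTERS `b`, `g`, `C`** (`PrintSlotHolder c β` mentions `c.L`, `c.Nper`, `c.ε`, `c.Λ₁`, `c.Λ₂'`, `c.dom` only): re-lettering an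
NE3 object in those three fields transports the slot (definitional; module 49's `leafSlotHolderAT_reletter` for the print slot). [folklore] -/
theorem printSlotHolder_reletter {N : ℕ} (F : T4Family) (o : NE3Objects₁₁ N) (b g C : ℝ) {β : ℝ} (h : PrintSlotHolder (ne3OfRecord₁₁ F o) β) :
    PrintSlotHolder (ne3OfRecord₁₁ F { o with b := b, g := g, C := C }) β :=
  h

variable {N : ℕ} [NeZero N] {β : ℝ}

/-! ## §1 Per family: letters of record at the loose object from `hE` and a loose linear leaf, WITH THE TWO CLASS-RADIUS ROWS exported -/

/-- **PER FAMILY, AT THE LOOSE-DATA OBJECT, WITH THE CLASS-RADIUS ROWS** — dag-n16-w1's `…N16H7LooseOfThm1At.exists_letters_inEndRegimeH_leafSlotHolderAT_of_edges_loose`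
(letters of record `ℓ` with `ℓ.g = g`, `ℓ.Λ₁ =` THE END's radius, `ℓ.C =` its constant, `0 < ℓ.b`, N21's numeral, `0 < ℓ.Λ₂'`, and `InEndRegimeH ∧ PrintSlotHolder · β` at
`oL = {ne3ConstLayerOfRecord₁₁ F N ℓ with dom := loose data at radius ℓ.ε∕B}`, from node N16's chain-entry object `hE` and a loose linear leaf `h7L`) PLUS the two rows on the CLASS radius that
node N19′'s link reading displays: `16·C0 4·ℓ.ε ≤ 3` and `1024·(4+1)·(4+4)·(F.L)²·ℓ.ε ≤ 1` — read off this seat's window lemma (`ℓ.ε < α`, `α ≤ c2' 4 F.L ∕ 2`, `α ≤ 1∕10^9`).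
Proof = file 6 §1's, two arithmetic lines added. [folklore] -/
theorem exists_letters_inEndRegimeH_printSlotHolder_classRadius_of_entry_loose (F : T4Family) {g : ℝ} (hg : 0 < g)
    (hE : ∃ B Bh c₁' : ℝ, 0 < B ∧ 0 < c₁' ∧ 16 * (B * c₁') ≤ 1 ∧
      ∀ k, 1 ≤ k → Thm4TorusAt F.L k (((ne3NperOfRecord₁₁ F 0 0 * F.L ^ k : ℕ) : ℤ)) (((F.L : ℝ) ^ k)⁻¹) c₁' (unitaryUnits (Matrix (Fin N) (Fin N) ℂ))
        (fun _ => True) (Restr129 F.L k (torusLam k))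
        (fun (α₀ α₁ : ℝ) (U₀ U' : Site 4 → Fin 4 → (Matrix (Fin N) (Fin N) ℂ)ˣ) (u : Site 4 → (Matrix (Fin N) (Fin N) ℂ)ˣ) =>
          ∃ A : Site 4 → Fin 4 → Matrix (Fin N) (Fin N) ℂ,
            (∀ x μ, IsSelfAdjoint (A x μ)) ∧ (∀ (x : Site 4) (κ μ : Fin 4), A (x + (((ne3NperOfRecord₁₁ F 0 0 * F.L ^ k : ℕ) : ℤ)) • e κ) μ = A x μ) ∧
            mgauge U₀ u (cfgExp (((F.L : ℝ) ^ k)⁻¹) A) = U' ∧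
            (∀ x μ, ‖A x μ‖ ≤ B * (α₀ + α₁)) ∧
            (∀ (μ : Fin 4) (x : Site 4) (κ : Fin 4), ‖covDerivFwd (((F.L : ℝ) ^ k)⁻¹) U₀ μ (fun z => A z κ) x‖ ≤ B * (α₀ + α₁)) ∧
            IsLandau138 F.L k (((F.L : ℝ) ^ k)⁻¹) Set.univ (torusLam k) U₀ A ∧
            (∀ (μ : Fin 4) (y : Site 4) (κ : Fin 4),
              ‖Ad (U₀ y μ) (covDerivFwd (((F.L : ℝ) ^ k)⁻¹) U₀ μ (fun z => A z κ) (y + e μ)) - covDerivFwd (((F.L : ℝ) ^ k)⁻¹) U₀ μ (fun z => A z κ) y‖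
                ≤ Bh * (α₀ + α₁) * (((F.L : ℝ)⁻¹) ^ k) ^ β) ∧
            (∀ (x : Site 4) (κ : Fin 4), ‖covLap (((F.L : ℝ) ^ k)⁻¹) U₀ (fun z => A z κ) x‖ ≤ B * (α₀ + α₁))))
    {B : ℝ}
    (h7L : ∃ C ε₀ : ℝ, 0 ≤ C ∧ 0 < ε₀ ∧ ∀ ε : ℝ, 0 < ε → ε ≤ ε₀ →
      LeafH3sup 4 F.L (ne3NperOfRecord₁₁ F 0 0) ε (C * ε) (C * ε)
        {V | V ∈ ne3DomOfRecord₁₁ F N 0 0 ∧ V ∈ sfClass 4 F.L (ne3NperOfRecord₁₁ F 0 0) (ε / B) 0}) :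
    ∃ ℓ : NE3Letters₁₁, ℓ.g = g ∧ ℓ.Λ₁ = radiusOfRecordH N F.L (ne3NperOfRecord₁₁ F 0 0) ∧ ℓ.C = constOfRecordH N F.L (ne3NperOfRecord₁₁ F 0 0) g ∧
      0 < ℓ.b ∧ 512 * (4 + 1) * (4 + 4) * (F.L : ℝ) ^ 2 * ℓ.b ≤ 1 ∧ 0 < ℓ.Λ₂' ∧
      16 * C0 4 * ℓ.ε ≤ 3 ∧ 1024 * (4 + 1) * (4 + 4) * (F.L : ℝ) ^ 2 * ℓ.ε ≤ 1 ∧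
      InEndRegimeH (ne3OfRecord₁₁ F
        { ne3ConstLayerOfRecord₁₁ F N ℓ with
          dom := {V | V ∈ ne3DomOfRecord₁₁ F N 0 0 ∧ V ∈ sfClass 4 F.L (ne3NperOfRecord₁₁ F 0 0) (ℓ.ε / B) 0} }) ∧
      PrintSlotHolder (ne3OfRecord₁₁ F
        { ne3ConstLayerOfRecord₁₁ F N ℓ with
          dom := {V | V ∈ ne3DomOfRecord₁₁ F N 0 0 ∧ V ∈ sfClass 4 F.L (ne3NperOfRecord₁₁ F 0 0) (ℓ.ε / B) 0} }) β := by
  obtain ⟨B₅, Bh, c₁', hB₅, hc₁', h16, hT⟩ := hE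
  obtain ⟨C, ε₀, hC, hε₀, h3⟩ := h7L
  have hL : 2 ≤ F.L := HistoryFlow.two_le_L F
  obtain ⟨α, ℓ, hα, hα1, hα2, hα3, hα4, hα5, hgℓ, hε0, hε, hεε₀, hCε, hεr, hΛ₁, hb0, hb, hCℓ, hΛ₂', hΛ₂'0, hnum⟩ :=
    exists_window_letters_entry F hc₁' hB₅ Bh g (radiusOfRecordH_pos (N := N) hL (one_le_ne3NperOfRecord₁₁ F 0 0))
      (constOfRecordH N F.L (ne3NperOfRecord₁₁ F 0 0) g) hC hε₀
  -- the two CLASS-RADIUS rows, from `ℓ.ε < α ≤ min (c2' 4 F.L ∕ 2) (1∕10^9)`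
  have hrowC : 16 * C0 4 * ℓ.ε ≤ 3 := by
    have hC0 : C0 4 = 23142400 := by simp only [C0]; norm_num
    have h9 : ℓ.ε ≤ 1 / 10 ^ 9 := hε.le.trans hα5
    rw [hC0]
    linarith
  have hrowL : 1024 * (4 + 1) * (4 + 4) * (F.L : ℝ) ^ 2 * ℓ.ε ≤ 1 := by
    have hc2 : c2' 4 F.L = 1 / (512 * ((4 : ℝ) + 1) * (4 + 4) * (F.L : ℝ) ^ 2) := by simp only [c2']; push_cast; ring
    have hK : 0 < 512 * ((4 : ℝ) + 1) * (4 + 4) * (F.L : ℝ) ^ 2 := by positivity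
    have h1 : ℓ.ε ≤ 1 / (512 * ((4 : ℝ) + 1) * (4 + 4) * (F.L : ℝ) ^ 2) / 2 := hε.le.trans (hc2 ▸ hα3)
    rw [le_div_iff₀ (by norm_num : (0 : ℝ) < 2), le_div_iff₀ hK] at h1
    linarith
  -- the loose-data object at the chosen radius (file 6 §1 verbatim from here)
  set oL : NE3Objects₁₁ N := { ne3ConstLayerOfRecord₁₁ F N ℓ with
      dom := {V | V ∈ ne3DomOfRecord₁₁ F N 0 0 ∧ V ∈ sfClass 4 F.L (ne3NperOfRecord₁₁ F 0 0) (ℓ.ε / B) 0} } with hoL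
  have hΛpos : 0 < ℓ.Λ₁ := by rw [hΛ₁]; exact radiusOfRecordH_pos (N := N) hL (one_le_ne3NperOfRecord₁₁ F 0 0)
  have hgpos : 0 < ℓ.g := by rw [hgℓ]; exact hg
  refine ⟨ℓ, hgℓ, hΛ₁, hCℓ, hb0, hnum, hΛ₂'0, hrowC, hrowL,
    inEndRegimeH_ofRecord_of_window F oL (one_le_ne3NperOfRecord₁₁ F 0 0) hgpos hB₅.le hα2 hε0 hε hΛ₁.le hb0.le hb
      (show constOfRecordH N F.L (ne3NperOfRecord₁₁ F 0 0) ℓ.g ≤ ℓ.C by rw [hCℓ, hgℓ]), ?_⟩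
  have hCε0 : 0 ≤ C * ℓ.ε := mul_nonneg hC hε0.le
  exact printSlotHolder_ofRecord_of_entry_window_linear F oL hB₅ hc₁' h16 hα hα1 hα2 hα3 hα4 hα5 hε hΛpos hΛ₂' hCε0 hCε hCε0
    (hCε.trans (by linarith only [hα.le] : α / 2048 ≤ α / 24)) (fun k hk => hT k hk) (h3 ℓ.ε hε0 hεε₀)

/-! ## §2 Per family at the SLOT KEY (§1 ∘ dag-n16-w1's `h7Shape_loose_of_reg910Slot`, as (9b)) -/

/-- **PER FAMILY, AT THE LOOSE OBJECT OF RADIUS `ℓ.ε ∕ C.B₃`, FROM `hE` AND THE SLOT KEY, WITH THE CLASS-RADIUS ROWS** — dag-n16-w1's (9b)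
`exists_letters_inEndRegimeH_leafSlotHolderAT_of_h5_reg910Slot` with §1's two extra exported rows. [cite: Balaban1985Variational, Thm 1 (9)–(10) p.279] [folklore] -/
theorem exists_letters_inEndRegimeH_printSlotHolder_classRadius_of_entry_reg910Slot (F : T4Family) {g : ℝ} (hg : 0 < g)
    (hE : ∃ B Bh c₁' : ℝ, 0 < B ∧ 0 < c₁' ∧ 16 * (B * c₁') ≤ 1 ∧
      ∀ k, 1 ≤ k → Thm4TorusAt F.L k (((ne3NperOfRecord₁₁ F 0 0 * F.L ^ k : ℕ) : ℤ)) (((F.L : ℝ) ^ k)⁻¹) c₁' (unitaryUnits (Matrix (Fin N) (Fin N) ℂ))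
        (fun _ => True) (Restr129 F.L k (torusLam k))
        (fun (α₀ α₁ : ℝ) (U₀ U' : Site 4 → Fin 4 → (Matrix (Fin N) (Fin N) ℂ)ˣ) (u : Site 4 → (Matrix (Fin N) (Fin N) ℂ)ˣ) =>
          ∃ A : Site 4 → Fin 4 → Matrix (Fin N) (Fin N) ℂ,
            (∀ x μ, IsSelfAdjoint (A x μ)) ∧ (∀ (x : Site 4) (κ μ : Fin 4), A (x + (((ne3NperOfRecord₁₁ F 0 0 * F.L ^ k : ℕ) : ℤ)) • e κ) μ = A x μ) ∧
            mgauge U₀ u (cfgExp (((F.L : ℝ) ^ k)⁻¹) A) = U' ∧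
            (∀ x μ, ‖A x μ‖ ≤ B * (α₀ + α₁)) ∧
            (∀ (μ : Fin 4) (x : Site 4) (κ : Fin 4), ‖covDerivFwd (((F.L : ℝ) ^ k)⁻¹) U₀ μ (fun z => A z κ) x‖ ≤ B * (α₀ + α₁)) ∧
            IsLandau138 F.L k (((F.L : ℝ) ^ k)⁻¹) Set.univ (torusLam k) U₀ A ∧
            (∀ (μ : Fin 4) (y : Site 4) (κ : Fin 4),
              ‖Ad (U₀ y μ) (covDerivFwd (((F.L : ℝ) ^ k)⁻¹) U₀ μ (fun z => A z κ) (y + e μ)) - covDerivFwd (((F.L : ℝ) ^ k)⁻¹) U₀ μ (fun z => A z κ) y‖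
                ≤ Bh * (α₀ + α₁) * (((F.L : ℝ)⁻¹) ^ k) ^ β) ∧
            (∀ (x : Site 4) (κ : Fin 4), ‖covLap (((F.L : ℝ) ^ k)⁻¹) U₀ (fun z => A z κ) x‖ ≤ B * (α₀ + α₁))))
    {G : (Site 4 → Fin 4 → (MatA N)ˣ) → Site 4 → ℕ → ℝ → ℝ → ℝ → Prop} (hGm : RadiiMono 4 G)
    (hG : ∀ (U : Site 4 → Fin 4 → (MatA N)ˣ) (x : Site 4) (K : ℕ) (α₀ α₁ α₂ : ℝ), 2 ≤ K → G U x K α₀ α₁ α₂ →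
      ∃ (u : Site 4 → (MatA N)ˣ) (a : Site 4 → Fin 4 → MatA N),
        (∀ z, u z ∈ unitaryUnits (MatA N)) ∧
        (∀ (y : Site 4) (τ : Fin 4), l1 (y - x) ≤ 2 → ((gaugeAct u U y τ : (MatA N)ˣ) : MatA N) = exp (a y τ)) ∧
        (∀ (y : Site 4) (τ : Fin 4), l1 (y - x) ≤ 2 → ‖a y τ‖ ≤ α₀) ∧
        (∀ (y : Site 4) (τ i : Fin 4), l1 (y - x) ≤ 1 → ‖fd i (fun z => a z τ) y‖ ≤ α₁) ∧
        (∀ (τ i l : Fin 4), ‖fd i (fd l (fun z => a z τ)) x‖ ≤ α₂))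
    (C : B11Thm1.Consts)
    (hR : ∀ (k : ℕ) (ε₁ : ℝ), 0 < ε₁ → ε₁ ≤ C.a₁ → ∀ (V U : Site 4 → Fin 4 → (MatA N)ˣ), V ∈ sfClass 4 F.L (ne3NperOfRecord₁₁ F 0 0) ε₁ 0 →
      IsMinimiser 4 (sfClass 4 F.L (ne3NperOfRecord₁₁ F 0 0) (C.B₃ * ε₁)) F.L (ne3NperOfRecord₁₁ F 0 0) (k + 1) V U →
        ∀ x : Site 4, Regularity (torusVP 4 F.L (ne3NperOfRecord₁₁ F 0 0) G (k + 1)) C.B₃ C.B₄ ε₁ U (x, F.L ^ (k + 1) - 1 + F.L ^ (k + 1) + 2)) :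
    ∃ ℓ : NE3Letters₁₁, ℓ.g = g ∧ ℓ.Λ₁ = radiusOfRecordH N F.L (ne3NperOfRecord₁₁ F 0 0) ∧ ℓ.C = constOfRecordH N F.L (ne3NperOfRecord₁₁ F 0 0) g ∧
      0 < ℓ.b ∧ 512 * (4 + 1) * (4 + 4) * (F.L : ℝ) ^ 2 * ℓ.b ≤ 1 ∧ 0 < ℓ.Λ₂' ∧
      16 * C0 4 * ℓ.ε ≤ 3 ∧ 1024 * (4 + 1) * (4 + 4) * (F.L : ℝ) ^ 2 * ℓ.ε ≤ 1 ∧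
      InEndRegimeH (ne3OfRecord₁₁ F
        { ne3ConstLayerOfRecord₁₁ F N ℓ with
          dom := {V | V ∈ ne3DomOfRecord₁₁ F N 0 0 ∧ V ∈ sfClass 4 F.L (ne3NperOfRecord₁₁ F 0 0) (ℓ.ε / C.B₃) 0} }) ∧
      PrintSlotHolder (ne3OfRecord₁₁ F
        { ne3ConstLayerOfRecord₁₁ F N ℓ with
          dom := {V | V ∈ ne3DomOfRecord₁₁ F N 0 0 ∧ V ∈ sfClass 4 F.L (ne3NperOfRecord₁₁ F 0 0) (ℓ.ε / C.B₃) 0} }) β :=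
  exists_letters_inEndRegimeH_printSlotHolder_classRadius_of_entry_loose F hg hE
    (h7Shape_loose_of_reg910Slot (le_trans one_le_two (HistoryFlow.two_le_L F)) hGm hG C hR (ne3DomOfRecord₁₁ F N 0 0))

/-! ## §3 ★ The producer with ALL NINE N16-letter rows (module 49 §3's shape; the coupling letter is OUTPUT) -/

section Producer

variable (hβ1 : β ≤ 1)
include hβ1

/-- **★ THE PRODUCER OF THE THREE N16 CONJUNCTS WITH NODE N19′'s COMPLETE N16-LETTER BLOCK** — module 49's ★ `exists_letters_n16HolderAtReading_loose_squeeze_of_h5_reg910Slot`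
(from node N16's chain-entry object `hE`, a local-gauge shape `G F` with the (9)_{β₀=1} interface, constants `C F`, the SLOT KEY `hR`; letters `ℓ₃`, radius letter `B F := max (C F).B₃ (4ε∕c' F)`,
sup letter `c' F := min (ε∕(2^76·L^12)) (1∕(2^91·L^17))`, `(ℓ₃ F).b := c' F`, `(ℓ₃ F).g := gradConst 4 (c' F)`) with the rows conjunct now carrying, besides the radii rows, the
two CLASS-RADIUS rows `16·C0 4·(ℓ₃ F).ε ≤ 3 ∧ 1024·(4+1)·(4+4)·(F.L)²·(ℓ₃ F).ε ≤ 1` (§2). [cite: Balaban1985Variational, Thm 1 (9)–(10) p.279] [folklore] -/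
theorem exists_letters_n16HolderAtReading_loose_squeezeFull_of_entry_reg910Slot
    (hE : ∀ F : T4Family, ∃ B Bh c₁' : ℝ, 0 < B ∧ 0 < c₁' ∧ 16 * (B * c₁') ≤ 1 ∧
      ∀ k, 1 ≤ k → Thm4TorusAt F.L k (((ne3NperOfRecord₁₁ F 0 0 * F.L ^ k : ℕ) : ℤ)) (((F.L : ℝ) ^ k)⁻¹) c₁' (unitaryUnits (Matrix (Fin N) (Fin N) ℂ))
        (fun _ => True) (Restr129 F.L k (torusLam k))
        (fun (α₀ α₁ : ℝ) (U₀ U' : Site 4 → Fin 4 → (Matrix (Fin N) (Fin N) ℂ)ˣ) (u : Site 4 → (Matrix (Fin N) (Fin N) ℂ)ˣ) =>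
          ∃ A : Site 4 → Fin 4 → Matrix (Fin N) (Fin N) ℂ,
            (∀ x μ, IsSelfAdjoint (A x μ)) ∧ (∀ (x : Site 4) (κ μ : Fin 4), A (x + (((ne3NperOfRecord₁₁ F 0 0 * F.L ^ k : ℕ) : ℤ)) • e κ) μ = A x μ) ∧
            mgauge U₀ u (cfgExp (((F.L : ℝ) ^ k)⁻¹) A) = U' ∧
            (∀ x μ, ‖A x μ‖ ≤ B * (α₀ + α₁)) ∧
            (∀ (μ : Fin 4) (x : Site 4) (κ : Fin 4), ‖covDerivFwd (((F.L : ℝ) ^ k)⁻¹) U₀ μ (fun z => A z κ) x‖ ≤ B * (α₀ + α₁)) ∧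
            IsLandau138 F.L k (((F.L : ℝ) ^ k)⁻¹) Set.univ (torusLam k) U₀ A ∧
            (∀ (μ : Fin 4) (y : Site 4) (κ : Fin 4),
              ‖Ad (U₀ y μ) (covDerivFwd (((F.L : ℝ) ^ k)⁻¹) U₀ μ (fun z => A z κ) (y + e μ)) - covDerivFwd (((F.L : ℝ) ^ k)⁻¹) U₀ μ (fun z => A z κ) y‖
                ≤ Bh * (α₀ + α₁) * (((F.L : ℝ)⁻¹) ^ k) ^ β) ∧
            (∀ (x : Site 4) (κ : Fin 4), ‖covLap (((F.L : ℝ) ^ k)⁻¹) U₀ (fun z => A z κ) x‖ ≤ B * (α₀ + α₁))))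
    {G : T4Family → (Site 4 → Fin 4 → (MatA N)ˣ) → Site 4 → ℕ → ℝ → ℝ → ℝ → Prop} (hGm : ∀ F, RadiiMono 4 (G F))
    (hG : ∀ (F : T4Family) (U : Site 4 → Fin 4 → (MatA N)ˣ) (x : Site 4) (K : ℕ) (α₀ α₁ α₂ : ℝ), 2 ≤ K → G F U x K α₀ α₁ α₂ →
      ∃ (u : Site 4 → (MatA N)ˣ) (a : Site 4 → Fin 4 → MatA N),
        (∀ z, u z ∈ unitaryUnits (MatA N)) ∧
        (∀ (y : Site 4) (τ : Fin 4), l1 (y - x) ≤ 2 → ((gaugeAct u U y τ : (MatA N)ˣ) : MatA N) = exp (a y τ)) ∧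
        (∀ (y : Site 4) (τ : Fin 4), l1 (y - x) ≤ 2 → ‖a y τ‖ ≤ α₀) ∧
        (∀ (y : Site 4) (τ i : Fin 4), l1 (y - x) ≤ 1 → ‖fd i (fun z => a z τ) y‖ ≤ α₁) ∧
        (∀ (τ i l : Fin 4), ‖fd i (fd l (fun z => a z τ)) x‖ ≤ α₂))
    (C : T4Family → B11Thm1.Consts)
    (hR : ∀ (F : T4Family) (k : ℕ) (ε₁ : ℝ), 0 < ε₁ → ε₁ ≤ (C F).a₁ → ∀ (V U : Site 4 → Fin 4 → (MatA N)ˣ), V ∈ sfClass 4 F.L (ne3NperOfRecord₁₁ F 0 0) ε₁ 0 →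
      IsMinimiser 4 (sfClass 4 F.L (ne3NperOfRecord₁₁ F 0 0) ((C F).B₃ * ε₁)) F.L (ne3NperOfRecord₁₁ F 0 0) (k + 1) V U →
        ∀ x : Site 4, Regularity (torusVP 4 F.L (ne3NperOfRecord₁₁ F 0 0) (G F) (k + 1)) (C F).B₃ (C F).B₄ ε₁ U (x, F.L ^ (k + 1) - 1 + F.L ^ (k + 1) + 2)) :
    ∃ (ℓ₃ : T4Family → NE3Letters₁₁) (B c' : T4Family → ℝ), N16LettersEnd N (fun F => gradConst 4 (c' F)) ℓ₃ ∧
      (∀ F : T4Family, 0 < B F ∧ (ℓ₃ F).ε / B F ≤ (ℓ₃ F).b) ∧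
      (∀ F : T4Family, (C F).B₃ ≤ B F ∧ (2 : ℝ) ^ 78 * (F.L : ℝ) ^ 12 ≤ B F) ∧
      (∀ F : T4Family, (ℓ₃ F).g = gradConst 4 (c' F) ∧ 0 ≤ c' F ∧ 0 < c' F ∧ (ℓ₃ F).b ≤ c' F ∧
        (2 : ℝ) ^ 91 * (F.L : ℝ) ^ 17 * c' F ≤ 1 ∧ (2 : ℝ) ^ 76 * (F.L : ℝ) ^ 12 * c' F ≤ (ℓ₃ F).ε ∧
        16 * C0 4 * (ℓ₃ F).ε ≤ 3 ∧ 1024 * (4 + 1) * (4 + 4) * (F.L : ℝ) ^ 2 * (ℓ₃ F).ε ≤ 1 ∧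
        (ℓ₃ F).ε / B F ≤ 1 / 4 ∧ 4 * ((ℓ₃ F).ε / B F) ≤ c' F) ∧
      ∀ 𝔯 : RateReading₁₃CoPH N, N16PinnedLoose 𝔯 ℓ₃ B → N16HolderAtReading 𝔯 β := by
  -- the letters of record at the loose object of radius `ε ∕ B₃`, from `hE` and the slot key, at the auxiliary coupling letter `1`, with the class-radius rows
  choose ℓ hℓ using fun F => exists_letters_inEndRegimeH_printSlotHolder_classRadius_of_entry_reg910Slot (N := N) F one_pos (hE F) (hGm F) (hG F) (C F) (hR F)
  have hε0 : ∀ F, 0 < (ℓ F).ε := fun F => (hℓ F).2.2.2.2.2.2.2.2.1.2.2.2.1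
  have hL1 : ∀ F : T4Family, (1 : ℝ) ≤ F.L := fun F => by exact_mod_cast le_trans one_le_two (HistoryFlow.two_le_L F)
  -- the squeezed scalars per family (module 49)
  have hs := fun F => squeezeLetters_spec (hL1 F) (hε0 F) (C F).B₃_pos
  refine ⟨fun F => ⟨(ℓ F).ε, min ((ℓ F).ε / ((2 : ℝ) ^ 76 * (F.L : ℝ) ^ 12)) (1 / ((2 : ℝ) ^ 91 * (F.L : ℝ) ^ 17)),
      gradConst 4 (min ((ℓ F).ε / ((2 : ℝ) ^ 76 * (F.L : ℝ) ^ 12)) (1 / ((2 : ℝ) ^ 91 * (F.L : ℝ) ^ 17))),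
      constOfRecordH N F.L (ne3NperOfRecord₁₁ F 0 0) (gradConst 4 (min ((ℓ F).ε / ((2 : ℝ) ^ 76 * (F.L : ℝ) ^ 12)) (1 / ((2 : ℝ) ^ 91 * (F.L : ℝ) ^ 17)))),
      (ℓ F).Λ₁, (ℓ F).Λ₂'⟩,
    fun F => max (C F).B₃ (4 * (ℓ F).ε / min ((ℓ F).ε / ((2 : ℝ) ^ 76 * (F.L : ℝ) ^ 12)) (1 / ((2 : ℝ) ^ 91 * (F.L : ℝ) ^ 17))),
    fun F => min ((ℓ F).ε / ((2 : ℝ) ^ 76 * (F.L : ℝ) ^ 12)) (1 / ((2 : ℝ) ^ 91 * (F.L : ℝ) ^ 17)),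
    fun F => ⟨rfl, (hℓ F).2.1, rfl, (hs F).1, (hs F).2.2.2.2.1, (hℓ F).2.2.2.2.2.1, ?_⟩,
    fun F => ⟨(hs F).2.2.2.2.2.1, (hs F).2.2.2.2.2.2.2.1⟩, fun F => ⟨(hs F).2.2.2.2.2.2.1, (hs F).2.2.2.2.2.2.2.2.2.2⟩,
    fun F => ⟨rfl, (hs F).1.le, (hs F).1, le_rfl, (hs F).2.1, (hs F).2.2.1, (hℓ F).2.2.2.2.2.2.1, (hℓ F).2.2.2.2.2.2.2.1,
      (hs F).2.2.2.2.2.2.2.2.1, (hs F).2.2.2.2.2.2.2.2.2.1⟩,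
    fun 𝔯 hpin => n16HolderAtReading_of_pinnedLoose β hpin fun F => ?_⟩
  · -- THE END's regime at the re-lettered constant layer (module 49 §1 transport of §2's `InEndRegimeH`; the regime does not read the data)
    have hreg := inEndRegimeH_reletter F _ (ne3DomOfRecord₁₁ F N 0 0) (hℓ F).2.2.2.2.2.2.2.2.1 (gradConst_four_pos (hs F).1) (hs F).1.le (hs F).2.2.2.1 le_rfl
    exact hreg
  · -- the N16 conjunct: closer at radius `ε ∕ B₃` on the re-lettered loose object, then antitonicity down to radius `ε ∕ B`
    have hreg := inEndRegimeH_reletter F _ {V | V ∈ ne3DomOfRecord₁₁ F N 0 0 ∧ V ∈ sfClass 4 F.L (ne3NperOfRecord₁₁ F 0 0) ((ℓ F).ε / (C F).B₃) 0}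
      (hℓ F).2.2.2.2.2.2.2.2.1 (gradConst_four_pos (hs F).1) (hs F).1.le (hs F).2.2.2.1 le_rfl
    have hH := n16HolderAt_of_inEndRegimeH_printSlotHolder hreg hβ1 (printSlotHolder_reletter F _ _ _ _ (hℓ F).2.2.2.2.2.2.2.2.2)
    have hres := n16HolderAt_anti_dom F (looseDom_anti F (hε0 F).le (C F).B₃_pos (hs F).2.2.2.2.2.2.1) hH
    exact hres

/-! ## §4 The K3-stub-1 shape: the coupling letter displayed as a function `g` -/

/-- **★ THE SAME IN K3's STUB-1 SHAPE `∃ ℓ₃ g B`**: letters `ℓ₃`, coupling letter `g` (`> 0`, `g F = gradConst 4 (c' F)`), radius letter `B`, sup letter `c'`, with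
`N16LettersEnd N g ℓ₃`, the MATCH row, the floor, ALL NINE N16-letter rows of node N19′ at `t := c' F`, and the N16 conjunct at every reading pinned loose at `ℓ₃, B`.
[cite: Balaban1985Variational, Thm 1 (9)–(10) p.279] [folklore] -/
theorem exists_letters_g_n16HolderAtReading_loose_squeezeFull_of_entry_reg910Slot
    (hE : ∀ F : T4Family, ∃ B Bh c₁' : ℝ, 0 < B ∧ 0 < c₁' ∧ 16 * (B * c₁') ≤ 1 ∧
      ∀ k, 1 ≤ k → Thm4TorusAt F.L k (((ne3NperOfRecord₁₁ F 0 0 * F.L ^ k : ℕ) : ℤ)) (((F.L : ℝ) ^ k)⁻¹) c₁' (unitaryUnits (Matrix (Fin N) (Fin N) ℂ))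
        (fun _ => True) (Restr129 F.L k (torusLam k))
        (fun (α₀ α₁ : ℝ) (U₀ U' : Site 4 → Fin 4 → (Matrix (Fin N) (Fin N) ℂ)ˣ) (u : Site 4 → (Matrix (Fin N) (Fin N) ℂ)ˣ) =>
          ∃ A : Site 4 → Fin 4 → Matrix (Fin N) (Fin N) ℂ,
            (∀ x μ, IsSelfAdjoint (A x μ)) ∧ (∀ (x : Site 4) (κ μ : Fin 4), A (x + (((ne3NperOfRecord₁₁ F 0 0 * F.L ^ k : ℕ) : ℤ)) • e κ) μ = A x μ) ∧
            mgauge U₀ u (cfgExp (((F.L : ℝ) ^ k)⁻¹) A) = U' ∧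
            (∀ x μ, ‖A x μ‖ ≤ B * (α₀ + α₁)) ∧
            (∀ (μ : Fin 4) (x : Site 4) (κ : Fin 4), ‖covDerivFwd (((F.L : ℝ) ^ k)⁻¹) U₀ μ (fun z => A z κ) x‖ ≤ B * (α₀ + α₁)) ∧
            IsLandau138 F.L k (((F.L : ℝ) ^ k)⁻¹) Set.univ (torusLam k) U₀ A ∧
            (∀ (μ : Fin 4) (y : Site 4) (κ : Fin 4),
              ‖Ad (U₀ y μ) (covDerivFwd (((F.L : ℝ) ^ k)⁻¹) U₀ μ (fun z => A z κ) (y + e μ)) - covDerivFwd (((F.L : ℝ) ^ k)⁻¹) U₀ μ (fun z => A z κ) y‖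
                ≤ Bh * (α₀ + α₁) * (((F.L : ℝ)⁻¹) ^ k) ^ β) ∧
            (∀ (x : Site 4) (κ : Fin 4), ‖covLap (((F.L : ℝ) ^ k)⁻¹) U₀ (fun z => A z κ) x‖ ≤ B * (α₀ + α₁))))
    {G : T4Family → (Site 4 → Fin 4 → (MatA N)ˣ) → Site 4 → ℕ → ℝ → ℝ → ℝ → Prop} (hGm : ∀ F, RadiiMono 4 (G F))
    (hG : ∀ (F : T4Family) (U : Site 4 → Fin 4 → (MatA N)ˣ) (x : Site 4) (K : ℕ) (α₀ α₁ α₂ : ℝ), 2 ≤ K → G F U x K α₀ α₁ α₂ →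
      ∃ (u : Site 4 → (MatA N)ˣ) (a : Site 4 → Fin 4 → MatA N),
        (∀ z, u z ∈ unitaryUnits (MatA N)) ∧
        (∀ (y : Site 4) (τ : Fin 4), l1 (y - x) ≤ 2 → ((gaugeAct u U y τ : (MatA N)ˣ) : MatA N) = exp (a y τ)) ∧
        (∀ (y : Site 4) (τ : Fin 4), l1 (y - x) ≤ 2 → ‖a y τ‖ ≤ α₀) ∧
        (∀ (y : Site 4) (τ i : Fin 4), l1 (y - x) ≤ 1 → ‖fd i (fun z => a z τ) y‖ ≤ α₁) ∧
        (∀ (τ i l : Fin 4), ‖fd i (fd l (fun z => a z τ)) x‖ ≤ α₂))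
    (C : T4Family → B11Thm1.Consts)
    (hR : ∀ (F : T4Family) (k : ℕ) (ε₁ : ℝ), 0 < ε₁ → ε₁ ≤ (C F).a₁ → ∀ (V U : Site 4 → Fin 4 → (MatA N)ˣ), V ∈ sfClass 4 F.L (ne3NperOfRecord₁₁ F 0 0) ε₁ 0 →
      IsMinimiser 4 (sfClass 4 F.L (ne3NperOfRecord₁₁ F 0 0) ((C F).B₃ * ε₁)) F.L (ne3NperOfRecord₁₁ F 0 0) (k + 1) V U →
        ∀ x : Site 4, Regularity (torusVP 4 F.L (ne3NperOfRecord₁₁ F 0 0) (G F) (k + 1)) (C F).B₃ (C F).B₄ ε₁ U (x, F.L ^ (k + 1) - 1 + F.L ^ (k + 1) + 2)) :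
    ∃ (ℓ₃ : T4Family → NE3Letters₁₁) (g B c' : T4Family → ℝ), (∀ F, 0 < g F) ∧ N16LettersEnd N g ℓ₃ ∧
      (∀ F : T4Family, 0 < B F ∧ (ℓ₃ F).ε / B F ≤ (ℓ₃ F).b) ∧
      (∀ F : T4Family, (C F).B₃ ≤ B F ∧ (2 : ℝ) ^ 78 * (F.L : ℝ) ^ 12 ≤ B F) ∧
      (∀ F : T4Family, g F = gradConst 4 (c' F) ∧ (ℓ₃ F).g = gradConst 4 (c' F) ∧ 0 ≤ c' F ∧ (ℓ₃ F).b ≤ c' F ∧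
        (2 : ℝ) ^ 91 * (F.L : ℝ) ^ 17 * c' F ≤ 1 ∧ (2 : ℝ) ^ 76 * (F.L : ℝ) ^ 12 * c' F ≤ (ℓ₃ F).ε ∧
        16 * C0 4 * (ℓ₃ F).ε ≤ 3 ∧ 1024 * (4 + 1) * (4 + 4) * (F.L : ℝ) ^ 2 * (ℓ₃ F).ε ≤ 1 ∧
        (ℓ₃ F).ε / B F ≤ 1 / 4 ∧ 4 * ((ℓ₃ F).ε / B F) ≤ c' F) ∧
      ∀ 𝔯 : RateReading₁₃CoPH N, N16PinnedLoose 𝔯 ℓ₃ B → N16HolderAtReading 𝔯 β := by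
  obtain ⟨ℓ₃, B, c', hEnd, hM, hF, hrows, hH⟩ :=
    exists_letters_n16HolderAtReading_loose_squeezeFull_of_entry_reg910Slot (N := N) hβ1 hE hGm hG C hR
  exact ⟨ℓ₃, fun F => gradConst 4 (c' F), B, c', fun F => gradConst_four_pos (hrows F).2.2.1, hEnd, hM, hF,
    fun F => ⟨rfl, (hrows F).1, (hrows F).2.1, (hrows F).2.2.2.1, (hrows F).2.2.2.2.1, (hrows F).2.2.2.2.2.1, (hrows F).2.2.2.2.2.2.1,
      (hrows F).2.2.2.2.2.2.2.1, (hrows F).2.2.2.2.2.2.2.2.1, (hrows F).2.2.2.2.2.2.2.2.2⟩, hH⟩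

end Producer
end

end Summit.QuantumFields.YangMills.BalabanUVNodes.N16EntrySqueezeClassRadius
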